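import Literature.MathematicalPhysics.QuantumFieldTheory.Balaban1983to89.Beta.HessianTelescopingKKT

/-!
# K0⁷ ∕ NODE O lens-2 «flow-gronwall-ttel» — THE PRINTED PARITY (5.8) `Π_{μν}(x) = Π_{νμ}(−x)` IS INHERITED BY THE BY-VALUE TRANSPORT
# `K ↦ Lc⁸ · dressedEntry w K (Lc • z)` FOR EVERY TWO-SIDED DRESSING `w`, and what it does to the low moments (CRIT-1 CUT-1 S1's parity clause)

Cell `pub-ymgap`, width seat `pub-ymgap-dag-n07-w3` (g18; N07 [B11] ∕ K0⁷–K1 junction; helper strictly BELOW the |β|-box stub of K0⁷ stmt-QuantumFields-20541).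
`--kind proof --supports stmt-QuantumFields-20541 --as helper`, COUNT-NEUTRAL.  NEW leaf; theorems only — 0 `def`, 0 `sorry`; imports `Beta.HessianTelescopingKKT` only.

WHY.  The NODE O cover's lens-2 (crux idea `Cruxes/Record13SepCoPHInhabited/Ideas/flow-gronwall-ttel.md`; HOME `ym-nodeO-ideate/nodeO-cover/LENS-2-Sketch-v3.lean` §1) types the
linear part of T-TEL as the by-value transport `transport Lc j K := fun a b z => Lc⁸ · dressedEntry (wStep Lc j) K (Lc • z) a b` on the Ward + m₂-free kernels `WardFree K`, and its crux
P-α asks for a geometric contraction of the cocycle.  CRIT-1's CUT-1 (`…/CRIT-1-CUT1-lens2-flow-gronwall-ttel-v0.md` §2 S1) locates the ODD moments: `WardFree` kills m₀, m₁, m₂ but not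
m₃, so the generic rate is `Lc⁻¹`, and recommends — if the record's one-step kernels are EVEN under `(a, b, z) ↦ (b, a, −z)` («two-point Hessian kernels are») — to ADD that parity
to `WardFree`.  For that the parity must REPRODUCE ITSELF along the cocycle.  This file proves it does, for EVERY two-sided dressing weight `w` (no Strang–Fix input, no summability:
pure re-indexing of the `(u, x)`-family by the swap), and records what the parity alone gives on the moment side: the second-moment tensor is symmetric in the colour pair,
every odd moment is ANTISYMMETRIC in it, hence all DIAGONAL odd moments vanish (the off-diagonal ones do not by parity alone — they do under the axis reflections (5.7),
`Beta.OddMoments`, not used here).  The parity is print's (5.8) p.293 «Π_{μν}(x) = Π_{νμ}(−x)» read for a matrix kernel `K a b z`.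

CONTENTS.  §1 `dressedSum_neg` (scalar two-sided dressed sum at `−y` = the swapped dressed sum of the reflected kernel at `y`); §2 ★ `dressedEntry_neg_of_parity`
(`K c e (−t) = K e c t` ⟹ `dressedEntry w K (−y) a b = dressedEntry w K y b a`), ★ `transport_parity` (the same for `Lc⁸ · dressedEntry w K (Lc • z)`, any `Lc`, any `w` — in particular
`wStep Lc j` at every level `j`, so «WardFree ∧ parity» is as transport-stable as `WardFree`); §3 `m2Tensor_symm_of_parity`, `firstMoment_antisymm_of_parity`, `thirdMoment_antisymm_of_parity`,
`firstMoment_diag_eq_zero_of_parity`, `thirdMoment_diag_eq_zero_of_parity`.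

HONEST FRAMING (binding).  [folklore] re-indexing of unconditional sums; a HYPOTHESIS SHAPE (the parity) and its bookkeeping — nothing of Bałaban asserted, no kernel of the record is
shown to have the parity here, P-α itself is NOT touched (no norm, no rate); K0⁷ NOT closed; NODE O NOT inhabited; COUNT 8∕28 · K 1∕4 UNMOVED; R4 = the conditional finite-𝕋⁴ rung
`BalabanLadder.UV` only; NOT continuum ∕ ℝ⁴ ∕ OS; the Yang–Mills mass gap (Clay) is NOT proved by any of this.
-/

noncomputable section

namespace Summit.QuantumFields.YangMills.Theorems.K0TransportParity

open Literature.MathematicalPhysics.QuantumFieldTheory.Balaban1983to89.Beta.DecimatedMomentSummable (dressedSum)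
open Literature.MathematicalPhysics.QuantumFieldTheory.Balaban1983to89.Beta.DressedMomentNormalisation (EKer dressedEntry m2Tensor)

variable {d : ℕ}

/-! ## §1. The scalar two-sided dressed sum under `y ↦ −y` -/

/-- **Reflection of the output point swaps the two dressings and reflects the kernel**: `dressedSum w T w' (−y) = dressedSum w' (t ↦ T (−t)) w y` — re-index the `(u, x)`-family by the
swap; no summability needed (`Equiv.tsum_eq`). [folklore] -/
theorem dressedSum_neg (w T w' : (Fin d → ℤ) → ℝ) (y : Fin d → ℤ) :
    dressedSum w T w' (-y) = dressedSum w' (fun t => T (-t)) w y := by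
  unfold dressedSum
  rw [← (Equiv.prodComm (Fin d → ℤ) (Fin d → ℤ)).tsum_eq]
  refine tsum_congr fun p => ?_
  simp only [Equiv.prodComm_apply, Prod.fst_swap, Prod.snd_swap]
  rw [show -y + p.2 - p.1 = -(y + p.1 - p.2) by abel]
  ring

/-! ## §2. The parity (5.8) of a matrix kernel is inherited by the dressed entry and by the by-value transport, for EVERY weight -/

/-- **★ PARITY IS INHERITED BY THE TWO-SIDED DRESSED ENTRY** — if `K c e (−t) = K e c t` for all colours and sites (print's (5.8) «Π_{μν}(x) = Π_{νμ}(−x)»), then for EVERY dressing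
weight `w` (both sides the same `w`; no reproduction or summability hypothesis) `dressedEntry w K (−y) a b = dressedEntry w K y b a`. [cite: Balaban1987RG1, (5.8) p.293] -/
theorem dressedEntry_neg_of_parity (w K : EKer d) (hK : ∀ (c e : Fin d) (t : Fin d → ℤ), K c e (-t) = K e c t) (y : Fin d → ℤ) (a b : Fin d) :
    dressedEntry w K (-y) a b = dressedEntry w K y b a := by
  unfold dressedEntry
  rw [Finset.sum_comm]
  refine Finset.sum_congr rfl fun e _ => Finset.sum_congr rfl fun c _ => ?_
  rw [dressedSum_neg]
  refine congrArg (fun T => dressedSum (w e b) T (w c a) y) ?_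
  funext t
  exact hK c e t

/-- **★ THE BY-VALUE TRANSPORT PRESERVES THE PARITY, AT EVERY BLOCKING `Lc` AND FOR EVERY WEIGHT `w`** (so in particular for lens-2's `transport Lc j K = fun a b z ↦ Lc⁸ · dressedEntry
(wStep Lc j) K (Lc • z) a b` at every level `j`): `Lc⁸ · dressedEntry w K (Lc • (−z)) a b = Lc⁸ · dressedEntry w K (Lc • z) b a`.  Hence «`WardFree` ∧ parity» reproduces along the transport
cocycle exactly as `WardFree` does (`HessianTelescopingKKT.hasSum_dressedEntry_zero ∕ _first`, `hasSum_transport_m2Tensor`). [cite: Balaban1987RG1, (5.8) p.293] -/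
theorem transport_parity (Lc : ℕ) (w K : EKer d) (hK : ∀ (c e : Fin d) (t : Fin d → ℤ), K c e (-t) = K e c t) (z : Fin d → ℤ) (a b : Fin d) :
    (Lc : ℝ) ^ 8 * dressedEntry w K ((Lc : ℤ) • (-z)) a b = (Lc : ℝ) ^ 8 * dressedEntry w K ((Lc : ℤ) • z) b a := by
  rw [smul_neg, dressedEntry_neg_of_parity w K hK]

/-- The parity as a property of the transported kernel itself (curried form consumed by a `WardFree`-with-parity predicate). [cite: Balaban1987RG1, (5.8) p.293] -/
theorem transport_parity' (Lc : ℕ) (w K : EKer d) (hK : ∀ (c e : Fin d) (t : Fin d → ℤ), K c e (-t) = K e c t) :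
    ∀ (a b : Fin d) (z : Fin d → ℤ),
      (fun a' b' z' => (Lc : ℝ) ^ 8 * dressedEntry w K ((Lc : ℤ) • z') a' b') a b (-z)
        = (fun a' b' z' => (Lc : ℝ) ^ 8 * dressedEntry w K ((Lc : ℤ) • z') a' b') b a z :=
  fun a b z => transport_parity Lc w K hK z a b

/-! ## §3. What the parity gives on the moment side (no summability: unconditional sums re-indexed by `t ↦ −t`) -/

/-- Re-indexing an unconditional lattice sum by `t ↦ −t`. [folklore] -/
private theorem tsum_comp_neg (f : (Fin d → ℤ) → ℝ) : ∑' t : Fin d → ℤ, f (-t) = ∑' t : Fin d → ℤ, f t :=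
  (Equiv.neg (Fin d → ℤ)).tsum_eq f

/-- **The second-moment tensor of an even kernel is SYMMETRIC in the colour pair**: `m2Tensor K κ λ a b = m2Tensor K κ λ b a`. [cite: Balaban1987RG1, (5.8) p.293, (1.22) p.264] -/
theorem m2Tensor_symm_of_parity (K : EKer 4) (hK : ∀ (c e : Fin 4) (t : Fin 4 → ℤ), K c e (-t) = K e c t) (κ lam a b : Fin 4) :
    m2Tensor K κ lam a b = m2Tensor K κ lam b a := by
  unfold m2Tensor
  rw [← tsum_comp_neg (fun t => (t κ * t lam) • K a b t)]
  refine tsum_congr fun t => ?_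
  simp only [Pi.neg_apply, neg_mul_neg, hK a b t]

/-- **First moments of an even kernel are ANTISYMMETRIC in the colour pair**: `Σ' t, t_μ • K a b t = −Σ' t, t_μ • K b a t`. [cite: Balaban1987RG1, (5.8) p.293] -/
theorem firstMoment_antisymm_of_parity (K : EKer d) (hK : ∀ (c e : Fin d) (t : Fin d → ℤ), K c e (-t) = K e c t) (μ a b : Fin d) :
    ∑' t : Fin d → ℤ, t μ • K a b t = -∑' t : Fin d → ℤ, t μ • K b a t := by
  rw [← tsum_comp_neg (fun t => t μ • K a b t), ← tsum_neg]
  refine tsum_congr fun t => ?_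
  simp only [Pi.neg_apply, hK a b t, neg_smul]

/-- **Third moments of an even kernel are ANTISYMMETRIC in the colour pair**: `Σ' t, (t_κ t_λ t_μ) • K a b t = −Σ' t, (t_κ t_λ t_μ) • K b a t` — so the parity alone does NOT kill the
off-diagonal third moments (CRIT-1 S1: the `Lc⁻¹` channel of odd kernels), only relates them. [cite: Balaban1987RG1, (5.8) p.293] -/
theorem thirdMoment_antisymm_of_parity (K : EKer d) (hK : ∀ (c e : Fin d) (t : Fin d → ℤ), K c e (-t) = K e c t) (κ lam μ a b : Fin d) :
    ∑' t : Fin d → ℤ, (t κ * t lam * t μ) • K a b t = -∑' t : Fin d → ℤ, (t κ * t lam * t μ) • K b a t := by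
  rw [← tsum_comp_neg (fun t => (t κ * t lam * t μ) • K a b t), ← tsum_neg]
  refine tsum_congr fun t => ?_
  simp only [Pi.neg_apply, hK a b t]
  ring_nf

/-- **DIAGONAL first moments of an even kernel vanish**: `Σ' t, t_μ • K a a t = 0`. [cite: Balaban1987RG1, (5.8) p.293] -/
theorem firstMoment_diag_eq_zero_of_parity (K : EKer d) (hK : ∀ (c e : Fin d) (t : Fin d → ℤ), K c e (-t) = K e c t) (μ a : Fin d) :
    ∑' t : Fin d → ℤ, t μ • K a a t = 0 := by
  have h := firstMoment_antisymm_of_parity K hK μ a a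
  linarith

/-- **DIAGONAL third moments of an even kernel vanish**: `Σ' t, (t_κ t_λ t_μ) • K a a t = 0`. [cite: Balaban1987RG1, (5.8) p.293] -/
theorem thirdMoment_diag_eq_zero_of_parity (K : EKer d) (hK : ∀ (c e : Fin d) (t : Fin d → ℤ), K c e (-t) = K e c t) (κ lam μ a : Fin d) :
    ∑' t : Fin d → ℤ, (t κ * t lam * t μ) • K a a t = 0 := by
  have h := thirdMoment_antisymm_of_parity K hK κ lam μ a a
  linarith

end Summit.QuantumFields.YangMills.Theorems.K0TransportParity

end
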